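/-
Origin: expansion seat `prover-pub-hodgecm-mc-sinst-1-g5-0`, handover #1226 2026-08-20T11:06Z md5 dd15c256bc13 (125 l., 4 theorems) NEW additive leaf, ns HodgeCM.Model.ArchSideTerm; imports #1225 (this kit) + RUN-48 (K10) ArchSlotDeltaDischarge23; ROWDEPS #1223 #1224 #1225; `hSV_holds` + E's hΔ₂/hΔ₃ hypothesis-free at muSharp₂₃ μ; NAME LIST: HodgeCM.Model.ArchSideTerm.hSV_holds · HodgeCM.Model.ArchSideTerm.hΔ₂_GOG_muSharp₂₃_holds · HodgeCM.Model.ArchSideTerm.hΔ₃_GOG_muSharp₂₃_holds (`HOME/mc/pub-hodgecm-mc-sinst-1-g5/stage/HodgeCM/Model/ArchConjSlotVT.lean`, md5 dd15c256bc13, 125 lines);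
landed by the second packager p2 gen 7 (p2-g7) in gate run 50 as `HodgeCM/Model/ArchConjSlotVT.lean` (verbatim).
-/
/-
Origin: speedrun cell pub-hodgecm, MODEL-CONSTRUCTION sub-cell, lineage mc-sinst-1 (S-instance constructor, BINDER-OWNERS row 5 `S` / row 6 `μ`: (J-μ) slots 2/3 —
THE CAPSTONE: (K10)'s hypothesis `hSV` = (STRIP) ∧ (VT) as a theorem), seat prover-pub-hodgecm-mc-sinst-1-g5-0 (gen 5), 2026-08-20.
Target in PKG: `HodgeCM/Model/ArchConjSlotVT.lean` (NEW additive leaf; imports sinst `Model/ArchConjLeviVT` (same kit) + theta-3 RUN-48 (K10)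
`Model/ArchSlotDeltaDischarge23`).
KERNEL only: 0 records / `def … : Prop` / cites-as-hypotheses, 0 proof holes; intended closure {propext, Classical.choice, Quot.sound}.
-/
import Summits.HodgeConjecture.HodgeCM.Model.ArchConjLeviVT
import Summits.HodgeConjecture.HodgeCM.Model.ArchSlotDeltaDischarge23

/-!
# (J-μ) slots 2/3 CLOSED: `hSV` holds, so E's `hΔ₂` / `hΔ₃` are hypothesis-free at `μ♯♯`

theta-3's (K10) `ArchSlotDeltaDischarge23` discharges E's `hΔ₁ hΔ₂ hΔ₃` at the adapted table `μ♯♯ = muSharp₂₃ μ` from ONE hypothesis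
`hSV` («for every guarded `(V, c)` the conjugated see-saw tensor of the two primed test functions is `E(Y ⊗ F)` with
`Y = a • ω_∞(1, k) Φ_X`»).  This leaf PROVES `hSV`:

* **`hSV_holds hGR`** — from period-1's (STRIP) `ArchConjSlotStrip.exists_cmConjLineTensorFin_testFun_eq_tmul` (clauses 2 + 3: the tensor
  decomposition `(A_∞, M_f)` of `ω(r_F h₀)` and the pure-tensor form of the conjugated see-saw tensor), sinst's
  `ArchConjLeviVT.exists_reindex_archFactor_eq_smul_cmArchWeilRep_cmConjSeesawMp` ((VT): `R_e (A_∞ Φ) = a • ω_∞(1,k) ((R_e Φ) ∘ J_S)`, i.e.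
  W1–W5 + (K7)/(K9)/(K11) + #1219–#1225) and theta-3's (K9) `compCLM_conjFrameTransport_slotArchBox_linePhi` (`Φ_{X'} ∘ J_S = Φ_X`);
* **`hΔ₂_GOG_muSharp₂₃_holds`**, **`hΔ₃_GOG_muSharp₂₃_holds`**, **`hΔ_GOG_muSharp₂₃_holds`** — (K10)'s E-shaped discharges at `hSV_holds`:
  E's binder texts `hΔ₂` / `hΔ₃` (pins #1212/#1215/#1216, glue-1's children) at `μ ↦ muSharp₂₃ μ`, over E's binder functions `hGR hGR₀ hGR₁ hGR₂ hGR₃ μ`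
  ONLY — no residual hypothesis.

So the (J-μ) identities leave the E term: glue-1's next child takes `μ := muSharp₂₃ μ`, `hΔ₁ := hΔ₁_GOG_muSharp₂₃ …`,
`hΔ₂ := hΔ₂_GOG_muSharp₂₃_holds …`, `hΔ₃ := hΔ₃_GOG_muSharp₂₃_holds …`.  Nothing here is a claim of PerL/QW8; nothing is cited as a fact.

References: [Folland1989] G. B. Folland, *Harmonic Analysis in Phase Space*, Princeton UP 1989, Prop. (1.43), Prop. (1.50), (4.24);
[Weil1964] A. Weil, Acta Math. 111 (1964), Chap. III n° 37–38; [Kudla1984] §1.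
-/

set_option autoImplicit false

noncomputable section

open scoped Matrix Classical SchwartzMap TensorProduct
open NumberField.mixedEmbedding (mixedSpace)
open Literature.NumberTheory.Automorphic Literature.NumberTheory.Automorphic.UnitaryGroup Literature.NumberTheory.Weil1964
open Literature.NumberTheory.GelbartRogawski1991 Literature.NumberTheory.GelbartRogawski1991.UnitaryDualPair
open HodgeCM.PerL34
open HodgeCM.Model.HypCensus HodgeCM.Model.ArchLevi

namespace HodgeCM.Model.ArchSideTerm

section SV

variable
  (hGR : ∀ {L : CMField} {ι₁ : L →+* ℂ} (V : HermSpace3 L ι₁) (c : SeesawCtx L),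
    (cmSplittingDatum (L : Type) finProdFinEquiv (frameD V) (frameD_real V) (frameD_ne V) (dW c.D) (dW_real c.D)
      (dW_ne c.D)).CompatibleSplitting)

/-- **(STRIP) ∧ (VT) — (K10)'s hypothesis `hSV` IS A THEOREM**: for every guarded `(V, c)` the conjugated see-saw tensor of the two
primed test functions is a pure tensor `E(Y ⊗ F)` (period-1's `exists_cmConjLineTensorFin_testFun_eq_tmul`) whose archimedean factor is
`Y = a • ω_∞(1, k) Φ_X` (`ArchConjLeviVT.exists_reindex_archFactor_eq_smul_cmArchWeilRep_cmConjSeesawMp` + (K9)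
`compCLM_conjFrameTransport_slotArchBox_linePhi`). [cite: Folland1989, Prop. (1.43), Prop. (1.50), (4.24)] -/
theorem hSV_holds : ∀ {L : CMField} {ι₁ : L →+* ℂ} (V : HermSpace3 L ι₁) (c : SeesawCtx L) (hc : SInstance.GOG V c),
    ∃ (Y : 𝓢((Fin (3 * 2) → mixedSpace (↥(NumberField.maximalRealSubfield (L : Type)))), ℂ)) (F : FinSB (↥(NumberField.maximalRealSubfield (L : Type))) (Fin (3 * 2))) (a : ℂ),
      cmConjLineTensorFin (L : Type) finProdFinEquiv e₁ (frameD V) (frameD_real V) (frameD_ne V) (dW c.D) (dW_real c.D) (dW_ne c.D)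
          (dW' c.D) (dW'_real c.D) (dW'_ne c.D) c.D.isoGL (isoGL_hg₀ c.D)
          (SupplyInstance.testFun (↥(NumberField.maximalRealSubfield (L : Type))) (Fin 3)
            (linePhi V (dW' c.D 0) (dW'_real c.D 0) (dW'_ne c.D 0) (SInstance.hpos_GOG V c hc).2.2.1)
            (lineX₀ V (dW' c.D 0) (dW'_real c.D 0) (dW'_ne c.D 0) (SInstance.hpos_GOG V c hc).2.2.1) 1)
          (SupplyInstance.testFun (↥(NumberField.maximalRealSubfield (L : Type))) (Fin 3)
            (linePhi V (dW' c.D 1) (dW'_real c.D 1) (dW'_ne c.D 1) (SInstance.hpos_GOG V c hc).2.2.2)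
            (lineX₀ V (dW' c.D 1) (dW'_real c.D 1) (dW'_ne c.D 1) (SInstance.hpos_GOG V c hc).2.2.2) 1) =
        piSchwartzBruhatEquiv (↥(NumberField.maximalRealSubfield (L : Type))) (Fin (3 * 2)) (Y ⊗ₜ F) ∧
      Y = a • HypCensus.cmArchWeilRep (L : Type) finProdFinEquiv (frameD V) (frameD_real V) (frameD_ne V) (dW c.D) (dW_real c.D) (dW_ne c.D)
        (hGR V c) (1, conjTransportK c.D) (ctxSlotArchBox V c (SInstance.hpos_GOG V c hc).1 (SInstance.hpos_GOG V c hc).2.1) := by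
  intro L ι₁ V c hc
  obtain ⟨A, Mf, -, hAM, hbox⟩ := exists_cmConjLineTensorFin_testFun_eq_tmul V c.D
  obtain ⟨F, hF⟩ := hbox (linePhi V (dW' c.D 0) (dW'_real c.D 0) (dW'_ne c.D 0) (SInstance.hpos_GOG V c hc).2.2.1)
    (linePhi V (dW' c.D 1) (dW'_real c.D 1) (dW'_ne c.D 1) (SInstance.hpos_GOG V c hc).2.2.2)
    (lineX₀ V (dW' c.D 0) (dW'_real c.D 0) (dW'_ne c.D 0) (SInstance.hpos_GOG V c hc).2.2.1)
    (lineX₀ V (dW' c.D 1) (dW'_real c.D 1) (dW'_ne c.D 1) (SInstance.hpos_GOG V c hc).2.2.2) 1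
  obtain ⟨a, ha⟩ := exists_reindex_archFactor_eq_smul_cmArchWeilRep_cmConjSeesawMp V c.D (hGR V c) A Mf hAM
  refine ⟨_, F, a, hF, ?_⟩
  have h := ha (conjSlotRawBox (L := L)
    (linePhi V (dW' c.D 0) (dW'_real c.D 0) (dW'_ne c.D 0) (SInstance.hpos_GOG V c hc).2.2.1)
    (linePhi V (dW' c.D 1) (dW'_real c.D 1) (dW'_ne c.D 1) (SInstance.hpos_GOG V c hc).2.2.2))
  rw [← slotArchBox_eq, compCLM_conjFrameTransport_slotArchBox_linePhi V c.D (SInstance.hpos_GOG V c hc).1 (SInstance.hpos_GOG V c hc).2.1] at h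
  exact h

variable
  (hGR₀ : ∀ {L : CMField} {ι₁ : L →+* ℂ} (V : HermSpace3 L ι₁) (c : SeesawCtx L),
    (cmSplittingDatum (L : Type) (e₁) (frameD V) (frameD_real V) (frameD_ne V) (lineVec (L : Type) (dW c.D 0))
      (fun _ => dW_real c.D 0) (fun _ => dW_ne c.D 0)).CompatibleSplitting)
  (hGR₁ : ∀ {L : CMField} {ι₁ : L →+* ℂ} (V : HermSpace3 L ι₁) (c : SeesawCtx L),
    (cmSplittingDatum (L : Type) (e₁) (frameD V) (frameD_real V) (frameD_ne V) (lineVec (L : Type) (dW c.D 1))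
      (fun _ => dW_real c.D 1) (fun _ => dW_ne c.D 1)).CompatibleSplitting)
  (hGR₂ : ∀ {L : CMField} {ι₁ : L →+* ℂ} (V : HermSpace3 L ι₁) (c : SeesawCtx L),
    (cmSplittingDatum (L : Type) (e₁) (frameD V) (frameD_real V) (frameD_ne V) (lineVec (L : Type) (dW' c.D 0))
      (fun _ => dW'_real c.D 0) (fun _ => dW'_ne c.D 0)).CompatibleSplitting)
  (hGR₃ : ∀ {L : CMField} {ι₁ : L →+* ℂ} (V : HermSpace3 L ι₁) (c : SeesawCtx L),
    (cmSplittingDatum (L : Type) (e₁) (frameD V) (frameD_real V) (frameD_ne V) (lineVec (L : Type) (dW' c.D 1))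
      (fun _ => dW'_real c.D 1) (fun _ => dW'_ne c.D 1)).CompatibleSplitting)
  (μ : ∀ {L : CMField}, SeesawCtx L → Fin 4 → NumberField.InfinitePlace L → ℤ)

/-- **E's `hΔ₂` AT `μ♯♯` — HYPOTHESIS-FREE** ((K10) `hΔ₂_GOG_muSharp₂₃` at `hSV_holds`): over E's binder functions `hGR hGR₀..₃ μ` only. -/
theorem hΔ₂_GOG_muSharp₂₃_holds : ∀ {L : CMField} {ι₁ : L →+* ℂ} (V : HermSpace3 L ι₁) (c : SeesawCtx L), ∀ hc : SInstance.GOG V c,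
    slotTypeVec V c (hGR V c) (hGR₀ V c) (hGR₁ V c) (hGR₂ V c) (hGR₃ V c) (SInstance.hG_GOG V c hc) 2 -
      slotTypeVec V c (hGR V c) (hGR₀ V c) (hGR₁ V c) (hGR₂ V c) (hGR₃ V c) (SInstance.hG_GOG V c hc) 0 =
        muSharp₂₃ μ c 2 - muSharp₂₃ μ c 0 :=
  hΔ₂_GOG_muSharp₂₃ hGR hGR₀ hGR₁ hGR₂ hGR₃ μ (hSV_holds hGR)

/-- **E's `hΔ₃` AT `μ♯♯` — HYPOTHESIS-FREE.** -/
theorem hΔ₃_GOG_muSharp₂₃_holds : ∀ {L : CMField} {ι₁ : L →+* ℂ} (V : HermSpace3 L ι₁) (c : SeesawCtx L), ∀ hc : SInstance.GOG V c,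
    slotTypeVec V c (hGR V c) (hGR₀ V c) (hGR₁ V c) (hGR₂ V c) (hGR₃ V c) (SInstance.hG_GOG V c hc) 3 -
      slotTypeVec V c (hGR V c) (hGR₀ V c) (hGR₁ V c) (hGR₂ V c) (hGR₃ V c) (SInstance.hG_GOG V c hc) 0 =
        muSharp₂₃ μ c 3 - muSharp₂₃ μ c 0 :=
  hΔ₃_GOG_muSharp₂₃ hGR hGR₀ hGR₁ hGR₂ hGR₃ μ (hSV_holds hGR)

/-- **ALL of E's `hΔ_k`, `k ≠ 0`, AT `μ♯♯` — HYPOTHESIS-FREE** ((K10) `hΔ_GOG_muSharp₂₃` at `hSV_holds`; `k = 1` is (TD)). -/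
theorem hΔ_GOG_muSharp₂₃_holds : ∀ {L : CMField} {ι₁ : L →+* ℂ} (V : HermSpace3 L ι₁) (c : SeesawCtx L), ∀ hc : SInstance.GOG V c,
    ∀ k : Fin 4, k ≠ 0 →
      slotTypeVec V c (hGR V c) (hGR₀ V c) (hGR₁ V c) (hGR₂ V c) (hGR₃ V c) (SInstance.hG_GOG V c hc) k -
        slotTypeVec V c (hGR V c) (hGR₀ V c) (hGR₁ V c) (hGR₂ V c) (hGR₃ V c) (SInstance.hG_GOG V c hc) 0 =
          muSharp₂₃ μ c k - muSharp₂₃ μ c 0 :=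
  hΔ_GOG_muSharp₂₃ hGR hGR₀ hGR₁ hGR₂ hGR₃ μ (hSV_holds hGR)

end SV

end HodgeCM.Model.ArchSideTerm

end
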